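import Literature.Probability.Percolation.KozmaNitzanReduction
import Literature.Probability.LatticeModels.ProdBernoulliIndependence
import Literature.Probability.Percolation.PercolationProofs
import HarnessLib

/-!
# Kozma–Nitzan's Question 5 has a unique answer for `|A| = 2`

Kozma–Nitzan (arXiv:2401.12397, §5.1, Question 5, p. 32) ask whether for every finite weighted
graph, every vertex `o` and every vertex set `A` there are coefficients `c_a ≥ 0`, `Σ_a c_a = 1`,
**independent of `b`**, with `P(o ↔ b) ≥ Σ_{a∈A} c_a · P(o ↔ A, a ↔ b)` for every vertex `b`
(their (38)); such coefficients give the pre-FKG inequality (3) at once, and for `|A| = 2` the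
proof of their Theorem 1 shows that `(α, β)` of their (5),
`α = P(o↔a₁, a₁↮a₂) / (P(o↔a₁, a₁↮a₂) + P(o↔a₂, a₁↮a₂))`, works.

This file records the elementary converse: for `|A| = 2` the coefficients are **forced**.  Testing
(38) only at `b = a₁` and `b = a₂` (where `{o ↔ A, a₂ ↔ a₁} = {o ↔ a₁ ↔ a₂}` and
`{o ↔ A, a₁ ↔ a₁} = {o ↔ A}`), additivity of the measure over `{a₁ ↔ a₂}` versus `{a₁ ↮ a₂}`
turns the two constraints into `c₁ · P(o↔A, a₁↮a₂) ≤ P(o↔a₁, a₁↮a₂)` and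
`c₂ · P(o↔A, a₁↮a₂) ≤ P(o↔a₂, a₁↮a₂)`, whose sum is an equality; hence both are equalities
(`q5_pair_coeff_eq`) and `c = (α, β)` whenever `P(o↔A, a₁↮a₂) > 0` (`q5_pair_coeff_unique`).
No correlation inequality is used, and `c ≥ 0` is not needed.

Context (solo seat `solo-CriticalPhenomena-informed`, census `paper/sharpest-statement.md` §5d):
for `|A| = 3` the polytope of admissible `b`-independent coefficients is no longer a point, and the
"random-walk coefficients" of KN §5.2 (normalised) lie outside it on a 7-vertex graph
(exact computation, CLAIMS C27), although they satisfy (38) on every graph with at most 6 vertices.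
-/

noncomputable section

namespace Summit.CriticalPhenomena.PercolationContinuityZ3.Theorems

open MeasureTheory Literature.Probability.Percolation Literature.Probability.LatticeModels

variable {n : ℕ}

/-- `{o ↔ A} ∩ {a₁ ↔ a₂} = {o ↔ a₁} ∩ {a₁ ↔ a₂}` for `A = {a₁, a₂}`. -/
theorem union_openConn_inter_openConn_left (o a₁ a₂ : Fin n) :
    ((openConn o a₁ ∪ openConn o a₂) ∩ openConn a₁ a₂ : Set (BondConfig (Fin n))) =
      openConn o a₁ ∩ openConn a₁ a₂ := by
  ext ω
  constructor
  · rintro ⟨h | h, h12⟩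
    · exact ⟨h, h12⟩
    · exact ⟨SimpleGraph.Reachable.trans h (SimpleGraph.Reachable.symm h12), h12⟩
  · rintro ⟨h, h12⟩
    exact ⟨Or.inl h, h12⟩

/-- `{o ↔ A} ∩ {a₁ ↔ a₂} = {o ↔ a₂} ∩ {a₁ ↔ a₂}` for `A = {a₁, a₂}`. -/
theorem union_openConn_inter_openConn_right (o a₁ a₂ : Fin n) :
    ((openConn o a₁ ∪ openConn o a₂) ∩ openConn a₁ a₂ : Set (BondConfig (Fin n))) =
      openConn o a₂ ∩ openConn a₁ a₂ := by
  ext ω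
  constructor
  · rintro ⟨h | h, h12⟩
    · exact ⟨SimpleGraph.Reachable.trans h h12, h12⟩
    · exact ⟨h, h12⟩
  · rintro ⟨h, h12⟩
    exact ⟨Or.inr h, h12⟩

/-- On `{a₁ ↮ a₂}` the events `{o ↔ a₁}` and `{o ↔ a₂}` are disjoint. -/
theorem disjoint_openConn_diff_openConn (o a₁ a₂ : Fin n) :
    Disjoint (openConn o a₁ \ openConn a₁ a₂ : Set (BondConfig (Fin n)))
      (openConn o a₂ \ openConn a₁ a₂) := by
  rw [Set.disjoint_left]
  rintro ω ⟨h1, hn⟩ ⟨h2, -⟩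
  exact hn (SimpleGraph.Reachable.trans (SimpleGraph.Reachable.symm h1) h2)

/-- **Question 5 is rigid for `|A| = 2`.**  If `c₁ + c₂ = 1` and KN's (38) holds at `b = a₁` and at
`b = a₂` (written out: `{o ↔ A} = {o ↔ a₁} ∪ {o ↔ a₂}`), then
`c₁ · P(o ↔ A, a₁ ↮ a₂) = P(o ↔ a₁, a₁ ↮ a₂)` and `c₂ · P(o ↔ A, a₁ ↮ a₂) = P(o ↔ a₂, a₁ ↮ a₂)`.
[cite: KozmaNitzan2024, Question 5 (p. 32), (5) (p. 7)] -/
theorem q5_pair_coeff_eq (w : Sym2 (Fin n) → unitInterval) (o a₁ a₂ : Fin n) (c₁ c₂ : ℝ)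
    (hsum : c₁ + c₂ = 1)
    (h₁ : c₁ * (prodBernoulli w).real ((openConn o a₁ ∪ openConn o a₂) ∩ openConn a₁ a₁) +
        c₂ * (prodBernoulli w).real ((openConn o a₁ ∪ openConn o a₂) ∩ openConn a₂ a₁) ≤
        (prodBernoulli w).real (openConn o a₁))
    (h₂ : c₁ * (prodBernoulli w).real ((openConn o a₁ ∪ openConn o a₂) ∩ openConn a₁ a₂) +
        c₂ * (prodBernoulli w).real ((openConn o a₁ ∪ openConn o a₂) ∩ openConn a₂ a₂) ≤
        (prodBernoulli w).real (openConn o a₂)) :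
    c₁ * (prodBernoulli w).real ((openConn o a₁ ∪ openConn o a₂) \ openConn a₁ a₂) =
        (prodBernoulli w).real (openConn o a₁ \ openConn a₁ a₂) ∧
      c₂ * (prodBernoulli w).real ((openConn o a₁ ∪ openConn o a₂) \ openConn a₁ a₂) =
        (prodBernoulli w).real (openConn o a₂ \ openConn a₁ a₂) := by
  have hE : MeasurableSet (openConn a₁ a₂ : Set (BondConfig (Fin n))) :=
    measurableSet_openConn_holds a₁ a₂
  have hcomm : (openConn a₂ a₁ : Set (BondConfig (Fin n))) = openConn a₁ a₂ := by
    ext ω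
    exact ⟨fun h => SimpleGraph.Reachable.symm h, fun h => SimpleGraph.Reachable.symm h⟩
  -- `{x ↔ x}` is the sure event (in the tree as `v1362_openConn_self`; kept local here)
  have hself : ∀ x : Fin n, (openConn x x : Set (BondConfig (Fin n))) = Set.univ := fun x =>
    Set.eq_univ_of_forall fun ω => (SimpleGraph.Reachable.refl x : ω ∈ openConn x x)
  rw [hself a₁, Set.inter_univ, hcomm, union_openConn_inter_openConn_left] at h₁
  rw [hself a₂, Set.inter_univ, union_openConn_inter_openConn_right] at h₂
  -- additivity over `{a₁ ↔ a₂}` / `{a₁ ↮ a₂}`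
  have sU : (prodBernoulli w).real ((openConn o a₁ ∪ openConn o a₂) ∩ openConn a₁ a₂) +
      (prodBernoulli w).real ((openConn o a₁ ∪ openConn o a₂) \ openConn a₁ a₂) =
      (prodBernoulli w).real (openConn o a₁ ∪ openConn o a₂ : Set (BondConfig (Fin n))) :=
    measureReal_inter_add_sdiff hE
  have s₁ : (prodBernoulli w).real (openConn o a₁ ∩ openConn a₁ a₂) +
      (prodBernoulli w).real (openConn o a₁ \ openConn a₁ a₂) =
      (prodBernoulli w).real (openConn o a₁ : Set (BondConfig (Fin n))) :=
    measureReal_inter_add_sdiff hE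
  have s₂ : (prodBernoulli w).real (openConn o a₂ ∩ openConn a₁ a₂) +
      (prodBernoulli w).real (openConn o a₂ \ openConn a₁ a₂) =
      (prodBernoulli w).real (openConn o a₂ : Set (BondConfig (Fin n))) :=
    measureReal_inter_add_sdiff hE
  have eL := congrArg (prodBernoulli w).real (union_openConn_inter_openConn_left o a₁ a₂)
  have eR := congrArg (prodBernoulli w).real (union_openConn_inter_openConn_right o a₁ a₂)
  -- `P(o ↔ A, a₁ ↮ a₂) = P(o ↔ a₁, a₁ ↮ a₂) + P(o ↔ a₂, a₁ ↮ a₂)`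
  have hsplit : (prodBernoulli w).real ((openConn o a₁ ∪ openConn o a₂) \ openConn a₁ a₂) =
      (prodBernoulli w).real (openConn o a₁ \ openConn a₁ a₂) +
        (prodBernoulli w).real (openConn o a₂ \ openConn a₁ a₂) := by
    rw [Set.union_sdiff_distrib]
    exact measureReal_union (disjoint_openConn_diff_openConn o a₁ a₂)
      ((measurableSet_openConn_holds o a₂).diff hE)
  have ea : (prodBernoulli w).real (openConn o a₂ ∩ openConn a₁ a₂) =
      (prodBernoulli w).real (openConn o a₁ ∩ openConn a₁ a₂ : Set (BondConfig (Fin n))) :=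
    eR.symm.trans eL
  rw [eL] at sU
  rw [ea] at h₂ s₂
  -- linearise: name the four masses
  set A := (prodBernoulli w).real (openConn o a₁ ∩ openConn a₁ a₂ : Set (BondConfig (Fin n)))
    with hA
  set D := (prodBernoulli w).real ((openConn o a₁ ∪ openConn o a₂) \ openConn a₁ a₂ :
    Set (BondConfig (Fin n))) with hD
  set B₁ := (prodBernoulli w).real (openConn o a₁ \ openConn a₁ a₂ : Set (BondConfig (Fin n)))
    with hB₁
  set B₂ := (prodBernoulli w).real (openConn o a₂ \ openConn a₁ a₂ : Set (BondConfig (Fin n)))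
    with hB₂
  have h₁' : c₁ * D ≤ B₁ := by
    have e : c₁ * (A + D) + c₂ * A = c₁ * D + (c₁ + c₂) * A := by ring
    rw [hsum, one_mul, sU] at e
    linarith
  have h₂' : c₂ * D ≤ B₂ := by
    have e : c₁ * A + c₂ * (A + D) = c₂ * D + (c₁ + c₂) * A := by ring
    rw [hsum, one_mul, sU] at e
    linarith
  have hcD : c₁ * D + c₂ * D = D := by rw [← add_mul, hsum, one_mul]
  constructor <;> linarith

/-- **Uniqueness of the `|A| = 2` certificate.**  Under the hypotheses of `q5_pair_coeff_eq` and
`P(o ↔ A, a₁ ↮ a₂) > 0`, the coefficients are KN's `(α, β)` of (5):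
`c₁ = P(o↔a₁, a₁↮a₂) / P(o↔A, a₁↮a₂)` and `c₂ = P(o↔a₂, a₁↮a₂) / P(o↔A, a₁↮a₂)`.
[cite: KozmaNitzan2024, Question 5 (p. 32), Thm. 1 and (5) (p. 7)] -/
theorem q5_pair_coeff_unique (w : Sym2 (Fin n) → unitInterval) (o a₁ a₂ : Fin n) (c₁ c₂ : ℝ)
    (hsum : c₁ + c₂ = 1)
    (h₁ : c₁ * (prodBernoulli w).real ((openConn o a₁ ∪ openConn o a₂) ∩ openConn a₁ a₁) +
        c₂ * (prodBernoulli w).real ((openConn o a₁ ∪ openConn o a₂) ∩ openConn a₂ a₁) ≤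
        (prodBernoulli w).real (openConn o a₁))
    (h₂ : c₁ * (prodBernoulli w).real ((openConn o a₁ ∪ openConn o a₂) ∩ openConn a₁ a₂) +
        c₂ * (prodBernoulli w).real ((openConn o a₁ ∪ openConn o a₂) ∩ openConn a₂ a₂) ≤
        (prodBernoulli w).real (openConn o a₂))
    (hpos : 0 < (prodBernoulli w).real ((openConn o a₁ ∪ openConn o a₂) \ openConn a₁ a₂)) :
    c₁ = (prodBernoulli w).real (openConn o a₁ \ openConn a₁ a₂) /
        (prodBernoulli w).real ((openConn o a₁ ∪ openConn o a₂) \ openConn a₁ a₂) ∧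
      c₂ = (prodBernoulli w).real (openConn o a₂ \ openConn a₁ a₂) /
        (prodBernoulli w).real ((openConn o a₁ ∪ openConn o a₂) \ openConn a₁ a₂) := by
  obtain ⟨e₁, e₂⟩ := q5_pair_coeff_eq w o a₁ a₂ c₁ c₂ hsum h₁ h₂
  exact ⟨eq_div_of_mul_eq hpos.ne' e₁, eq_div_of_mul_eq hpos.ne' e₂⟩

end Summit.CriticalPhenomena.PercolationContinuityZ3.Theorems

end
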